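import Summits.BirchSwinnertonDyer.BirchSwinnertonDyer.Theorems.GenusKolyvaginAtTwoPowDvdShaCardAtTwoRTTwinShaLaddersFinal
import Summits.BirchSwinnertonDyer.BirchSwinnertonDyer.Theorems.GenusKolyvaginAtTwoPowDvdShaCardAtTwoRTKolyvaginSuppliesOfProp52
import HarnessLib

/-!
# Route `GenusKolyvaginAtTwo`, LINE 18 (L_T `PowDvdShaCardAtTwoRT`, stmt-BirchSwinnertonDyer-23242), stub L
# `stub_twinShaLaddersAtTwo` — ITS CONCLUSION ON ITS OWN FRAME FROM McCALLUM'S PROP. 5.2 AT 2, LITERALLY (P52)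

Seat `bsd-line-gk2-p2` g18 (PROVER seat 2/3, cell `bsd-f1-sign2`), `--supports stmt-BirchSwinnertonDyer-23242` (helper; closes
nothing). THEOREMS ONLY (no definition, no named fact, no `sorry`); BSD is not proved by any of this.

WHAT. `twinShaLadders_of_prop52AtTwo`: the conclusion of `stub_twinShaLaddersAtTwo` (route file, LINE 18 `plus_descent`), on the
stub's own binders (`2^{M₀} ∥ P(1)` in `E(K[1])`), from the SINGLE displayed K-side hypothesis (P52) — needed only when `M₀ ≥ 1` —
which is McCallum's Prop. 5.2 at `p = 2`, level `M = L ≥ M₀ + 1`, on deep square-free levels, in `kolyvaginClass` currency, for the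
non-trivial `τ ∈ Aut(K/ℚ)`: a bottom rung `k R = L` (`R ≥ 1`), and for every depth `1 ≤ r ≤ R` the order bound `ord c_L(n′) ∣ 2^{k r}`
over deep depth-`r` levels together with, for every family `u` of `≤ r` classes of `Sel_{2^L}(E/K)` in the `ε_r = −w(E)(−1)^r`
eigenspace, a deep depth-`r` level `n` and datum `d` with `ord c_L(n) = 2^{k r}` and `⟨c_L(n)⟩ ∩ ⟨u⟩ = 0`.
Composition: `kolyvaginSuppliesAtTwo_of_prop52` ((P52) ⟹ (KS), running-minimum ladder) and `twinShaLadders_of_kolyvaginSuppliesAtTwo'`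
((KS) ⟹ the two `ℚ`-side `Ш`-ladders; (R0) inside by `rankZero_side_of_rootNumber`); at `M₀ = 0` the ladder is empty (`T = 0`).
So, BY NAME, what LINE 18's engines owe stub L is (P52) and nothing else.

References: [McCallumLMS1991] §5 Prop. 5.2, Thm. 5.4; [GrossLMS1991] Thm. 1.3, §4 (4.1), Prop. 5.3; [Kolyvagin1990] Thm. A.
-/

set_option autoImplicit false
-- the Theorems namespace of this sub repeats the summit name by design (D-0017 nested layout)
set_option linter.dupNamespace false

noncomputable section

open scoped Classical

namespace Summit.BirchSwinnertonDyer.BirchSwinnertonDyer.Theorems.GenusExact.PlusDescent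

open WeierstrassCurve NumberField IsDedekindDomain Field Literature.NumberTheory.EllipticCurves
  Literature.NumberTheory.GaloisRepresentations Literature.NumberTheory.EllipticCurves.ModularForms AddSubgroup
open Summit.BirchSwinnertonDyer.BirchSwinnertonDyer.Theses.GenusKolyvaginAtTwo (KolyvaginRelationAtTwo)

/-- **STUB L's CONCLUSION ON ITS OWN FRAME FROM (P52) ALONE** — McCallum's Prop. 5.2 at `2` (level `L`, deep levels, both signs,
bottom rung), asked only when `M₀ ≥ 1`. [cite: McCallumLMS1991, §5 Prop. 5.2, Thm. 5.4] [cite: GrossLMS1991, Thm. 1.3, §4 (4.1), Prop. 5.3] -/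
theorem twinShaLadders_of_prop52AtTwo (hP : PubInputsAtTwo) (hQ2 : KolyvaginRelationAtTwo)
    (W : WeierstrassCurve ℚ) [W.IsElliptic] [W.IsGloballyMinimal] [NeZero (W.conductorNorm ℤ)] (hcm : ¬ W.HasCM)
    (hT : Odd W.tamagawaProduct) (K : Type) [Field K] [NumberField K] (hIQ : IsImaginaryQuadratic K)
    (hodd : Odd (NumberField.discr K)) (h3 : NumberField.discr K ≠ -3) (hHe : SatisfiesHeegnerHypothesis (W.conductorNorm ℤ) K)
    (hρ : ∀ n : ℕ, 0 < n → W.HasSurjectiveModNGaloisRep ((2 : ℤ) ^ n))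
    (Dt : ModularParametrizationData W (W.conductorNorm ℤ)) (β : ℤ) (ι : K →+* ℂ) (d₁ : KolyvaginHeegnerData Dt β ι 1)
    (hy : ¬ IsOfFinAddOrder d₁.derivedPoint) (M₀ : ℕ)
    (hM₀ : ∃ Q : (W.baseChange (ringClassField K ι 1)).toAffine.Point, ((2 ^ M₀ : ℕ) : ℤ) • Q = d₁.derivedPoint)
    (hndiv : ¬ ∃ Q : (W.baseChange (ringClassField K ι 1)).toAffine.Point, ((2 ^ (M₀ + 1) : ℕ) : ℤ) • Q = d₁.derivedPoint)
    (Wd : WeierstrassCurve ℚ) [Wd.IsElliptic] (hTw : ∃ C : VariableChange ℚ, C • W.quadraticTwist (NumberField.discr K : ℚ) = Wd)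
    (hKS : 0 < M₀ → ∀ τ : K ≃ₐ[ℚ] K, τ ≠ 1 → ∃ (L R : ℕ) (k : ℕ → ℕ), M₀ + 1 ≤ L ∧ 1 ≤ R ∧ k R = L ∧
      ∀ r : ℕ, 1 ≤ r → r ≤ R →
        k r ≤ L ∧
        (∀ (n : ℕ) (d : KolyvaginHeegnerData Dt β ι n), Squarefree n →
          (∀ ℓ ∈ n.primeFactors, Zhang2014.IsKolyvaginPrime (W.conductorNorm ℤ) W K 2 ℓ ∧ L ≤ Zhang2014.kolyvaginIndex W 2 ℓ) →
          n.primeFactors.card = r → addOrderOf (d.kolyvaginClass Nat.prime_two L) ∣ 2 ^ k r) ∧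
        (∀ (i : ℕ) (u : Fin i → galH1Torsion (W.baseChange K) ((2 ^ L : ℕ) : ℤ)), i ≤ r →
          (∀ j, u j ∈ selmerGroup (W.baseChange K) ((2 ^ L : ℕ) : ℤ) ∧
            conjAct W τ ((2 ^ L : ℕ) : ℤ) (u j) = (-W.rootNumber * (-1) ^ r) • u j) →
          ∃ (n : ℕ) (_ : Squarefree n)
            (_ : ∀ ℓ ∈ n.primeFactors, Zhang2014.IsKolyvaginPrime (W.conductorNorm ℤ) W K 2 ℓ ∧ L ≤ Zhang2014.kolyvaginIndex W 2 ℓ)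
            (_ : n.primeFactors.card = r) (d : KolyvaginHeegnerData Dt β ι n),
            addOrderOf (d.kolyvaginClass Nat.prime_two L) = 2 ^ k r ∧
            Disjoint (zmultiples (d.kolyvaginClass Nat.prime_two L)) (AddSubgroup.closure (Set.range u)))) :
    ∃ (T : ℕ) (M : ℕ → ℕ), (∀ j, M (j + 1) ≤ M j) ∧ M 0 = M₀ ∧ M (2 * T) = 0 ∧
      (∀ m < T, ∃ x : Fin (2 * m + 2) → W.galH1, (∀ i, resBaseChange W K (x i) ∈ (W.baseChange K).sha) ∧
        (∀ i, addOrderOf (x i) = 2 ^ (M (2 * m) - M (2 * m + 1))) ∧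
        ∀ c : Fin (2 * m + 2) → ℤ, ∑ i, c i • x i = 0 → ∀ i, ((2 ^ (M (2 * m) - M (2 * m + 1)) : ℕ) : ℤ) ∣ c i) ∧
      (∀ m < T, ∃ x : Fin (2 * m + 2) → Wd.galH1, (∀ i, resBaseChange Wd K (x i) ∈ (Wd.baseChange K).sha) ∧
        (∀ i, addOrderOf (x i) = 2 ^ (M (2 * m + 1) - M (2 * m + 2))) ∧
        ∀ c : Fin (2 * m + 2) → ℤ, ∑ i, c i • x i = 0 → ∀ i, ((2 ^ (M (2 * m + 1) - M (2 * m + 2)) : ℕ) : ℤ) ∣ c i) := by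
  rcases Nat.eq_zero_or_pos M₀ with rfl | hpos
  · exact ⟨0, fun _ ↦ 0, fun _ ↦ le_rfl, rfl, rfl, fun m hm ↦ absurd hm (Nat.not_lt_zero m),
      fun m hm ↦ absurd hm (Nat.not_lt_zero m)⟩
  · exact twinShaLadders_of_kolyvaginSuppliesAtTwo' hP hQ2 W hcm hT K hIQ hodd h3 hHe hρ Dt β ι d₁ hy M₀ hndiv Wd hTw
      (kolyvaginSuppliesAtTwo_of_prop52 W K hIQ hodd h3 hHe (hρ 1 one_pos) Dt β ι d₁ M₀ hM₀ (hKS hpos))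

end Summit.BirchSwinnertonDyer.BirchSwinnertonDyer.Theorems.GenusExact.PlusDescent

end
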